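import Summits.ValiantsHypothesis.ValiantsHypothesis.Theorems.MonotoneRestorationOrbitRestorationQPSupportBlocks
import HarnessLib

/-!
# Keyed blocks — tools (ORBIT currency, XXIa)

Route MonotoneRestoration, crux `OrbitRestorationQP` (stmt-ValiantsHypothesis-18293), namespace
`Summit.ValiantsHypothesis.ValiantsHypothesis.Theorems.KeyedBlocks`.  Lemmas for the keyed-block theorem
(`…OrbitRestorationQPKeyedBlocks.lean`): `exists_unit_fibre` (unique factorisation transports the fibres of any
equivariant unit-invariant label up to units), `ren_eq_of_swaps_in` (a permutation permuting `D` and fixing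
`T ∖ D` pointwise is generated, modulo the pointwise stabiliser of `T`, by transpositions of `D`),
`exists_perm_fix_smul_eq` (transporters fixing a prescribed set pointwise), `smul_eq_of_fix`.  Everything is
proved. [folklore]
-/

noncomputable section

open scoped Classical Pointwise

-- `Summit.ValiantsHypothesis.ValiantsHypothesis.…` is the tree's single-conjunct layout (Sub = Summit).
set_option linter.dupNamespace false

namespace Summit.ValiantsHypothesis.ValiantsHypothesis.Theorems

namespace KeyedBlocks

open Equiv Finset Literature.Computability.AlgebraicComplexity OrbitRestorationQPDepthThreeRung

variable {n : ℕ}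

/-! ### Transport of fibres up to units -/

/-- **Fibres of an equivariant, unit-invariant label are transported up to units.**  For `f = a · Π L` nonzero,
diagonally invariant, with degree-one factors, and a label `lab` into any `Sym(Fin n)`-set:
`σ · Π{ℓ ∈ L : lab ℓ = b} = c · Π{ℓ ∈ L : lab ℓ = σ • b}` with `c ≠ 0`. [folklore] -/
theorem exists_unit_fibre {β : Type} [MulAction (Perm (Fin n)) β] [DecidableEq β]
    {L : Multiset (MvPolynomial (Fin n × Fin n) ℂ)}
    {a : ℂ} (lab : MvPolynomial (Fin n × Fin n) ℂ → β)
    (B1 : ∀ (q : MvPolynomial (Fin n × Fin n) ℂ) (u : ℂ), u ≠ 0 → lab (MvPolynomial.C u * q) = lab q)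
    (B2 : ∀ (q : MvPolynomial (Fin n × Fin n) ℂ) (σ : Perm (Fin n)), lab (ren σ q) = σ • lab q)
    (hL1 : ∀ ℓ ∈ L, ℓ.totalDegree = 1) (hf0 : MvPolynomial.C a * L.prod ≠ 0)
    (hfix : ∀ σ : Perm (Fin n), ren σ (MvPolynomial.C a * L.prod) = MvPolynomial.C a * L.prod)
    (σ : Perm (Fin n)) (b : β) :
    ∃ c : ℂ, c ≠ 0 ∧ ren σ (L.filter fun ℓ => lab ℓ = b).prod =
      MvPolynomial.C c * (L.filter fun ℓ => lab ℓ = σ • b).prod := by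
  have hP : ∀ p q : MvPolynomial (Fin n × Fin n) ℂ, Associated p q → (lab p = σ • b ↔ lab q = σ • b) := by
    intro p q hpq
    obtain ⟨c, hc0, rfl⟩ := SupportBlocks.exists_C_of_associated hpq
    rw [B1 p c hc0]
  have h1 := SupportBlocks.map_mk_filter_eq hP (SupportBlocks.map_mk_map_ren_eq hL1 hf0 hfix σ)
  have h2 : (L.map (ren σ)).filter (fun ℓ => lab ℓ = σ • b) = (L.filter fun ℓ => lab ℓ = b).map (ren σ) := by
    rw [Multiset.filter_map]
    congr 1
    refine Multiset.filter_congr fun ℓ _ => ?_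
    simp only [Function.comp_apply, B2]
    constructor
    · intro h; simpa using congrArg (fun x => σ⁻¹ • x) h
    · intro h; rw [h]
  rw [h2] at h1
  have h3 := congrArg Multiset.prod h1
  rw [Associates.prod_mk, Associates.prod_mk, Associates.mk_eq_mk_iff_associated, ← map_multiset_prod] at h3
  obtain ⟨c, hc0, hc⟩ := SupportBlocks.exists_C_of_associated h3.symm
  exact ⟨c, hc0, hc⟩

/-! ### Permutations of a set generated by transpositions of a part -/

/-- If the pointwise stabiliser of `T` fixes `G` and the transpositions of `D` fix `G`, then every permutation
mapping `D` to itself and fixing `T ∖ D` pointwise fixes `G`. [folklore] -/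
theorem ren_eq_of_swaps_in {G : MvPolynomial (Fin n × Fin n) ℂ} {T D : Finset (Fin n)}
    (hT : ∀ τ : Perm (Fin n), (∀ x ∈ T, τ x = x) → ren τ G = G)
    (hD : ∀ x ∈ D, ∀ y ∈ D, ren (swap x y) G = G)
    (ρ : Perm (Fin n)) (hρD : ρ • D = D) (hρ : ∀ x ∈ T, x ∉ D → ρ x = x) : ren ρ G = G := by
  have hsub : ∀ π : Perm {x // x ∈ D}, ren (Perm.ofSubtype π) G = G := by
    intro π
    induction π using Perm.swap_induction_on with
    | one => rw [map_one, ren_one]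
    | swap_mul π x y hxy ih => rw [map_mul, Perm.ofSubtype_swap_eq, ren_mul, ih, hD x x.2 y y.2]
  have hmem : ∀ x, ρ x ∈ D ↔ x ∈ D := by
    intro x
    constructor
    · intro hx
      rw [← hρD, Finset.mem_smul_finset] at hx
      obtain ⟨y, hy, hxy⟩ := hx
      rw [Perm.smul_def] at hxy
      rwa [← ρ.injective hxy]
    · intro hx; rw [← hρD]; exact Finset.smul_mem_smul_finset hx
  set π : Perm {x // x ∈ D} := ρ.subtypePerm hmem with hπ
  have hρ1 : ∀ x ∈ D, Perm.ofSubtype π x = ρ x := fun x hx => by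
    rw [Perm.ofSubtype_apply_of_mem π hx]; rfl
  have hρ1' : ∀ x, x ∉ D → Perm.ofSubtype π x = x := fun x hx => Perm.ofSubtype_apply_of_not_mem π hx
  have hρ2 : ∀ x ∈ T, ((Perm.ofSubtype π)⁻¹ * ρ) x = x := by
    intro x hx
    rw [Perm.mul_apply, Perm.inv_eq_iff_eq]
    by_cases hxD : x ∈ D
    · rw [hρ1 x hxD]
    · rw [hρ x hx hxD, hρ1' x hxD]
  calc ren ρ G = ren (Perm.ofSubtype π * ((Perm.ofSubtype π)⁻¹ * ρ)) G := by rw [mul_inv_cancel_left]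
    _ = G := by rw [ren_mul, hT _ hρ2, hsub]

/-- A permutation fixing `K` pointwise carrying `A` to `B` (both disjoint from `K`, of the same size). [folklore] -/
theorem exists_perm_fix_smul_eq {K A B : Finset (Fin n)} (hA : Disjoint A K) (hB : Disjoint B K)
    (h : A.card = B.card) : ∃ ρ : Perm (Fin n), (∀ x ∈ K, ρ x = x) ∧ ρ • A = B := by
  let e : {x // x ∈ A} ≃ {x // x ∈ B} := Fintype.equivOfCardEq (by simp [h])
  let f : Fin n → Fin n := fun x => if hx : x ∈ A then (e ⟨x, hx⟩ : Fin n) else x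
  have hfA : ∀ x (hx : x ∈ A), f x = (e ⟨x, hx⟩ : Fin n) := fun x hx => by simp only [f, dif_pos hx]
  have hfK : ∀ x, x ∉ A → f x = x := fun x hx => by simp only [f, dif_neg hx]
  have hf : Set.InjOn f ↑(K ∪ A) := by
    intro x hx y hy hxy
    simp only [Finset.coe_union, Set.mem_union, Finset.mem_coe] at hx hy
    by_cases hxA : x ∈ A <;> by_cases hyA : y ∈ A
    · rw [hfA x hxA, hfA y hyA] at hxy
      have := e.injective (Subtype.ext hxy)
      simpa using this
    · rw [hfA x hxA, hfK y hyA] at hxy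
      have hyK : y ∈ K := hy.resolve_right hyA
      exact absurd hyK (Finset.disjoint_left.1 hB (hxy ▸ (e ⟨x, hxA⟩).2))
    · rw [hfK x hxA, hfA y hyA] at hxy
      have hxK : x ∈ K := hx.resolve_right hxA
      exact absurd hxK (Finset.disjoint_left.1 hB (hxy.symm ▸ (e ⟨y, hyA⟩).2))
    · rw [hfK x hxA, hfK y hyA] at hxy; exact hxy
  obtain ⟨ρ, hρ⟩ := Literature.ModelTheory.FiniteModelTheory.exists_perm_extend (K ∪ A) f hf
  refine ⟨ρ, fun x hx => ?_, ?_⟩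
  · rw [hρ x (Finset.mem_union_left _ hx), hfK x (Finset.disjoint_right.1 hA hx)]
  · apply Finset.eq_of_subset_of_card_le
    · intro y hy
      obtain ⟨x, hx, rfl⟩ := Finset.mem_smul_finset.1 hy
      rw [Perm.smul_def, hρ x (Finset.mem_union_right _ hx), hfA x hx]
      exact (e ⟨x, hx⟩).2
    · rw [Finset.card_smul_finset, h]

/-- A permutation fixing `K` pointwise maps `K` to itself. [folklore] -/
theorem smul_eq_of_fix {K : Finset (Fin n)} {ρ : Perm (Fin n)} (h : ∀ x ∈ K, ρ x = x) : ρ • K = K := by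
  apply Finset.eq_of_subset_of_card_le
  · intro y hy
    obtain ⟨x, hx, rfl⟩ := Finset.mem_smul_finset.1 hy
    rw [Perm.smul_def, h x hx]; exact hx
  · rw [Finset.card_smul_finset]


end KeyedBlocks

end Summit.ValiantsHypothesis.ValiantsHypothesis.Theorems

end
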